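import Summits.Ventures.GridStability.Bench.SMIBDeg6AK13postD10Data1
import Summits.Ventures.GridStability.Lyapunov.PolyRecastBox
import Mathlib.Tactic.Linarith
import Mathlib.Tactic.Positivity
import HarnessLib

/-!
# G1.SMIB+ «SMIB deg-6» — REGION-SIZE rider «SMIB-DEG6 BALL» (recast half): the gauge ellipsoid
# `σ² + κ² + ω²/36 ≤ (107/250)²` on `{h = 0}` lies in the certified sublevel piece `{V₆ ≤ 17/7}`

Venture GRIDFUSION, cell `gridfusion`; seat gridfusion-lyap-2 (g4), LOW rider (pattern of «#50′ BALL» p537844 / «#62′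
WSCC9-DEG4-BALL» p543377): a kernel INNER description of the certified set of the deg-6 toolchain-A certificate of rung G1.SMIB («+»
row; `Bench/SMIBDeg6AK13postD10{Data1,Data2,Part1,Part2,}.lean`, sos-5; A file `cert/A/SMIB-deg6-A-K13postD10.json` sha256
`ee9fd533380ca353…`; -roa companion `Bench/SMIBDeg6AK13postD10Roa(+Model).lean`, lyap-2 g4), so that the single-machine ROA sentence
of the deg-6 row names a concrete neighbourhood of the synchronous equilibrium. Inputs: the degree-6 literal `…_V_poly` (81
monomials) and the recast constraint(s) `…_h` of the Data file; the generic box majorant `Lyapunov/PolyRecastBox.lean` (p536818).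
NOTHING of the certificate is restated; generator `gen_ball.py smib6` (HOME/lean/lyap-2/g4/; `s` found by exact search on the 1/1000
grid, V_poly parsed from the TREE file).

WHAT IS PROVED (kernel). With `s = 107/250`: on `{h = 0}` (`h_j = κ_j² + σ_j² − 2κ_j`) the ellipsoid `sigma² + kappa² + omega²/36 ≤
s²` forces `|σ| ≤ s`, `0 ≤ κ ≤ s²/2`, `|ω| ≤ 6·s`, and the coefficient majorant of the quartic `V` on that box is `absBox B V_poly =
9231422771660045823050329284417638017/3814697265625000000000000000000000000 ≈ 2.419962 ≤ 17/7` (ONE `decide`); hence `V ≤ 17/7 = c`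
— THE ELLIPSOID LIES IN THE CERTIFIED PIECE (`…_V_le_level_of_ball`). `s` is the largest multiple of `1/1000` passing the test (at
`s + 1/1000` the majorant is ≈ 2.435156 > c). The ellipsoid is the certificate's own gauge ball `φ = σ² + κ² + ω²/36 ≤ s²` (ω in
rad/s); other aspect ratios give (exact scan in the generator, ω²-coefficient → angle reach / |ω| reach) 1 → 34.4°/0.60 (s =
601/1000), 1/4 → 32.8°/1.14 (s = 143/250), 1/100 → 18.2°/3.18 (s = 159/500). In the model's coordinates (`σ² + κ² = 2 − 2cos u ≤
u²`): every machine state of the MODEL with `(δ − δ*)² + ω²/36 ≤ (107/250)²` (angle displaced by ≤ 0.428 rad = 24.5° at synchronous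
speed, or a speed deviation ≤ 2.57 rad/s at the operating angle) starts inside the certified region (model half: sibling
`…RoaBallModel.lean`); the degree / rad·s⁻¹ / percent renderings of `s` are VALIDATED-column readings of the exact literal, nothing
more.

THREE COLUMNS. CERTIFIED (kernel): the inclusion «ellipsoid of gauge radius `107/250` ∩ {h = 0} ⊆ {V ≤ 17/7}» for the certificate's
`V` — a crude (coefficient-majorant) but exact inner estimate; the true inner radius is larger; an inner set of a CERTIFICATE's
sublevel piece, never «the ROA of the system». MODELLED: as the parent row (M′ = classical SMIB, model-1 `SMIB.polyField a b d` /
`SMIB.K13postD10`: Kundur 1994 Ex. 13.1 post-fault plant, `P_m′` per A1′ eq=b, `K_D = 10` from Ex. 12.2 variant (iii) — a MODELLED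
choice for an attractive certificate; MODEL-VALIDITY MV-1). VALIDATED: only the renderings of `s`. No sentence here says a machine
or a grid is stable.
-/

namespace Summit.Ventures.GridStability.Bench.SMIB

open Literature.Computation.Certificates Literature.Computation.Certificates.SOS
open Literature.Computation.Certificates.SOS.Poly
open Summit.Ventures.GridStability.Lyapunov

noncomputable section

/-- The box of the rider: `|σ| ≤ s`, `|κ| ≤ s²/2`, `|ω| ≤ 6·s` with `s = 107/250`, in the certificate's variable order
`(sigma, kappa, omega)`. [folklore] -/
def deg6_A_K13postD10_boxB : List ℚ := [107/250, 11449/125000, 321/125]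

set_option maxRecDepth 100000 in
/-- **The coefficient majorant of the quartic `V` on the box is below the level**: `absBox B V_poly ≤ 17/7`
(ONE `decide` over the 81 monomials; exact value `9231422771660045823050329284417638017/3814697265625000000000000000000000000`). [folklore] -/
theorem deg6_A_K13postD10_absBox_le :
    PolyRecast.absBox (vars deg6_A_K13postD10_boxB) deg6_A_K13postD10_V_poly ≤ 17 / 7 := by
  decide +kernel

/-- **«BALL» (recast coordinates): the ellipsoid lies in the certified piece.** For every point of `{h = 0}` with
`sigma² + kappa² + omega²/36 ≤ (107/250)²`: `V ≤ 17/7`. [folklore] -/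
theorem deg6_A_K13postD10_V_le_level_of_ball (sigma kappa omega : ℝ)
    (hh : deg6_A_K13postD10_h sigma kappa omega = 0)
    (hball : sigma ^ 2 + kappa ^ 2 + omega ^ 2 / 36 ≤ (107 / 250 : ℝ) ^ 2) :
    deg6_A_K13postD10_V sigma kappa omega ≤ 17 / 7 := by
  simp only [deg6_A_K13postD10_h, deg6_A_K13postD10_h_poly, eval_cons, eval_nil, Monomial.eval_eq, Monomial.evalFrom_cons, Monomial.evalFrom_nil,
    vars_cons_zero, vars_cons_succ] at hh
  push_cast at hh
  norm_num at hh
  have hb0 : |sigma| ≤ (107 / 250 : ℝ) := abs_le.2 (abs_le_of_sq_le_sq' (by nlinarith [sq_nonneg sigma, sq_nonneg kappa, sq_nonneg omega]) (by norm_num))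
  have hb1 : |kappa| ≤ (11449 / 125000 : ℝ) := abs_le.2 ⟨by nlinarith [hh, sq_nonneg sigma, sq_nonneg kappa, sq_nonneg omega], by nlinarith [hh, hball, sq_nonneg sigma, sq_nonneg kappa, sq_nonneg omega]⟩
  have hb2 : |omega| ≤ (321 / 125 : ℝ) := abs_le.2 (abs_le_of_sq_le_sq' (by nlinarith [sq_nonneg sigma, sq_nonneg kappa, sq_nonneg omega]) (by norm_num))
  have hB : ∀ i, |vars [sigma, kappa, omega] i| ≤ ((vars deg6_A_K13postD10_boxB i : ℚ) : ℝ) := by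
    intro i
    match i with
    | 0 => simpa [deg6_A_K13postD10_boxB] using hb0
    | 1 => simpa [deg6_A_K13postD10_boxB] using hb1
    | 2 => simpa [deg6_A_K13postD10_boxB] using hb2
    | n + 3 => simp [deg6_A_K13postD10_boxB, vars]
  have h := PolyRecast.eval_le_absBox hB deg6_A_K13postD10_V_poly
  have hc : ((PolyRecast.absBox (vars deg6_A_K13postD10_boxB) deg6_A_K13postD10_V_poly : ℚ) : ℝ) ≤ ((17 / 7 : ℚ) : ℝ) :=
    Rat.cast_le.2 deg6_A_K13postD10_absBox_le
  have hc' : ((17 / 7 : ℚ) : ℝ) = 17 / 7 := by norm_num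
  exact h.trans (hc.trans_eq hc')

end

end Summit.Ventures.GridStability.Bench.SMIB
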